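import Summits.BirchSwinnertonDyer.BirchSwinnertonDyer.Theorems.GoldfeldK12AdditiveTwoInertSevenKrizLi7Twist
import Summits.BirchSwinnertonDyer.Rank1Residual.X12.O11.RouteUMemberE4
import Summits.BirchSwinnertonDyer.Rank1Residual.X12.O11.RouteUMemberE8
import Summits.BirchSwinnertonDyer.Rank1Residual.X12.O11.RouteUMemberE88
import HarnessLib

set_option linter.dupNamespace false -- namespace `…BirchSwinnertonDyer.BirchSwinnertonDyer…` is the cell's (D-0017 nested layout)
set_option autoImplicit false

/-!
# K12₂″, the 7-INERT half — first MEMBERS of the Kriz–Li-on-the-twist rung: `n = 1` (`784`), `n = 2` (`3136⁻`), `n = 22`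

Cell `bsd-goldfeld`, seat `bsd-goldfeld-s1p-c201` (prover, gen 8); `--supports` stmt-BirchSwinnertonDyer-20044 (K12₂″).
Sequel of `…GoldfeldK12AdditiveTwoInertSevenKrizLi7Twist` (the class theorems A/B/C for `W ≅ 49a1^{(−4n)}` over an
auxiliary Heegner field `ℚ(√−r)`). THESES-FREE. Here the three members that need NO new computation: bsd-cm's ROUTE U
already landed both Bernoulli-unit certificates for `(n, r) = (1, 31)`, `(2, 47)` and `(22, 271)`
(`RouteU.norm_generalizedBernoulli_theta1/2_E4/_E8/_E88`, `decide +kernel` sums). All three lie on the INERT half of the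
additive cell (`(−1/7) = (−2/7) = (−22/7) = −1`: `7` is inert in `ℚ(i)`, `ℚ(√−2)`, `ℚ(√−22)`, so `X₀(49)` has no Heegner
point there and c301's Heegner-half T2/T2′ cannot reach them; bsd-cm's other even members `E20/E24/E40/E52/E68` are on
the Heegner half): the curves `784 = 49a1^{(−1)}`, `3136⁻ = 49a1^{(−2)}` (c301 g6 files I–II: rank `1`, `Ш[2] = 0`
unconditionally; `r_an = 1` there via the bsd.S31 hook) and `49a1^{(−22)}` (`N = 379456`, beyond every Miller rung).
Kit j267736 (this seat) cross-checks the six sums: `S₁ mod 49 = 28, 42, 28`, `S₂ mod 49 = 7, 42, 21` for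
`(1,31), (2,47), (22,271)`, and finds the least admissible `r` with both units for EVERY cert₁-unit `n ≤ 1200` of the
inert half (178/209 members, 40/43 primes; first primes `29 (r = 103)`, `37 (367)`, `53 (47)`, `109 (223)`, `113 (31)`).
What is proved, per member: (K) every level-`N(W)` Heegner point of a globally minimal model `W` over `ℚ(√−r)` has
infinite order (KL19 Thm. 1.20 only); (C′) K12₂″'s implication `corank₂(W) = 1 ⟹ r_an(W) = 1` OUTRIGHT (+ Modularity,
Gross–Zagier, Heegner rationality, `2`-parity) — which also hands bsd-cm's `RouteU.bsdp_seven_of_twist_cm7_E4/_E8` their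
binder `hr1` (for `E4/E8/E88`); (≤) `r_an(W) ≤ 1` with no Selmer/sign hypothesis. HONEST FRAMING: `p = 7`, RANK axis; witness members,
nothing about `p = 2`; K12₂″ stays OPEN; BSD is not proved by any of this. THEOREMS ONLY.

References: [KrizLi2019] Thm. 1.20, Rem. 1.21; [GrossZagier1986] I.(6.3), I.§7; [DokchitserDokchitserAnnals2010] Thm. 1.4;
[Washington1997] §5.1; [Cox2013] Lemma 1.14.
-/

noncomputable section

open scoped Classical NumberTheorySymbols

open NumberField WeierstrassCurve DirichletCharacter
open Literature.NumberTheory.EllipticCurves Literature.NumberTheory.EllipticCurves.Rank1Residual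
open Literature.NumberTheory.EllipticCurves.KrizLi2019 Literature.NumberTheory.LFunctions
open Literature.NumberTheory.EllipticCurves.ModularForms
open Literature.NumberTheory.QuadraticFields
open Summit.BirchSwinnertonDyer.Rank1Residual
open Summit.BirchSwinnertonDyer.Rank1Residual.X12.O11.RouteU

namespace Summit.BirchSwinnertonDyer.BirchSwinnertonDyer.Theorems.GoldfeldGoodTwists

/-! ## Members on the INERT half with NO new computation: `n = 1` (`784 = 49a1^{(−1)}`, `r = 31`) and `n = 2`
(`3136⁻ = 49a1^{(−2)}`, `r = 47`) — bsd-cm's landed certificates `RouteU.norm_generalizedBernoulli_theta1/2_E4/_E8` -/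

/-- **Member `n = 1` over `K = ℚ(√−31)`: every level-`784` Heegner point of a globally minimal model `W` of
`49a1^{(−4)} ≅ 49a1^{(−1)}` (the curve `784`; `(−1/7) = −1`: INERT half, no Heegner point of `X₀(49)` over `ℚ(i)`)
has infinite order**, granted KL19 Thm. 1.20 only — the two Bernoulli certificates are bsd-cm's kernel theorems
`RouteU.norm_generalizedBernoulli_theta1_E4` / `_theta2_E4` (`r = 31`: `31 ≡ 7 (8)`, `(−31/7) = 1`).
[cite: KrizLi2019, Thm. 1.20 (pp. 7–8) and Rem. 1.21] [cite: Washington1997, §5.1] -/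
theorem not_isOfFinAddOrder_heegnerPoint_twist_cm7_neg4_of_thm120
    (h120 : KrizLi2019.thm120_padicLogHeegner_unit_of_bernoulli)
    (W : WeierstrassCurve ℚ) [W.IsElliptic] [W.IsGloballyMinimal]
    (hW : ∃ C : VariableChange ℚ, C • W = cm7.quadraticTwist ((-(4 * ((1 : ℕ) : ℤ)) : ℤ) : ℚ))
    (K : Type) [Field K] [NumberField K] (hK : IsImaginaryQuadratic K) (hdK : NumberField.discr K = -((31 : ℕ) : ℤ))
    {P : (W.baseChange K).toAffine.Point}
    (hP : haveI : NeZero (W.conductorNorm ℤ) := ⟨(W.conductorNorm_pos_holds).ne'⟩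
      IsHeegnerPoint (W.conductorNorm ℤ) W K P) : ¬ IsOfFinAddOrder P :=
  not_isOfFinAddOrder_heegnerPoint_twist_cm7_even_of_thm120 (n := 1) (r := 31) (hr := ⟨by norm_num⟩)
    (by norm_num) squarefree_one (by norm_num) (by norm_num) (by norm_num) (by norm_num)
    (by rw [legendreSym_eq_ite 7 (by norm_num)]; decide)
    (fun q hq hqn _ => absurd (Nat.dvd_one.mp hqn) hq.ne_one)
    norm_generalizedBernoulli_theta1_E4 norm_generalizedBernoulli_theta2_E4 h120 W hW K hK hdK hP

/-- **Member `n = 1`, K12₂″'s implication OUTRIGHT for the models of `49a1^{(−4)}` (the curve `784`, INERT half):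
`corank_{ℤ₂} Sel_{2^∞}(W/ℚ) = 1 ⟹ ord_{s=1} L(W, s) = 1`** for every globally minimal `W ≅ 49a1^{(−4)}`, granted KL19
Thm. 1.20, Modularity, Gross–Zagier, Heegner rationality and `2`-parity (auxiliary field `ℚ(√−31)`; certificates
`RouteU.…_E4`). Hands bsd-cm's `RouteU.bsdp_seven_of_twist_cm7_E4` its binder `hr1` from the corank.
[cite: KrizLi2019, Thm. 1.20 (pp. 7–8)] [cite: GrossZagier1986, I.(6.3) and I.§7] [cite: DokchitserDokchitserAnnals2010, Thm. 1.4] -/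
theorem rankOneTwoConverse_twist_cm7_neg4_of_thm120
    (h120 : KrizLi2019.thm120_padicLogHeegner_unit_of_bernoulli) (hnf : exists_isNewformOf)
    (hGZ : ∀ (N : ℕ) [NeZero N] (V : WeierstrassCurve ℚ) (L : Type) [Field L] [NumberField L], gross_zagier N V L)
    (hHP : ∀ (V : WeierstrassCurve ℚ) (L : Type) [Field L] [NumberField L], exists_isHeegnerPoint V L)
    (hpar : ∀ (V : WeierstrassCurve ℚ) [V.IsElliptic], p_parity V 2)
    (W : WeierstrassCurve ℚ) [W.IsElliptic] [W.IsGloballyMinimal]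
    (hW : ∃ C : VariableChange ℚ, C • W = cm7.quadraticTwist ((-(4 * ((1 : ℕ) : ℤ)) : ℤ) : ℚ))
    (hco : W.selmerCorank 2 = 1) : W.analyticRank = 1 :=
  rankOneTwoConverse_twist_cm7_even_of_thm120 (n := 1) (r := 31) (hr := ⟨by norm_num⟩)
    (by norm_num) squarefree_one (by norm_num) (by norm_num) (by norm_num) (by norm_num)
    (by rw [legendreSym_eq_ite 7 (by norm_num)]; decide)
    (fun q hq hqn _ => absurd (Nat.dvd_one.mp hqn) hq.ne_one)
    norm_generalizedBernoulli_theta1_E4 norm_generalizedBernoulli_theta2_E4 h120 hnf hGZ hHP hpar W hW hco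

/-- **Member `n = 1`, unconditional shape: `r_an(W) + r_an(W^{(−31)}) = 1` and hence `r_an(W) ≤ 1`** for every
globally minimal `W ≅ 49a1^{(−4)}` (no Selmer or sign hypothesis). [cite: GrossZagier1986, I.§7] -/
theorem analyticRank_le_one_twist_cm7_neg4_of_thm120
    (h120 : KrizLi2019.thm120_padicLogHeegner_unit_of_bernoulli) (hnf : exists_isNewformOf)
    (hGZ : ∀ (N : ℕ) [NeZero N] (V : WeierstrassCurve ℚ) (L : Type) [Field L] [NumberField L], gross_zagier N V L)
    (hHP : ∀ (V : WeierstrassCurve ℚ) (L : Type) [Field L] [NumberField L], exists_isHeegnerPoint V L)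
    (W : WeierstrassCurve ℚ) [W.IsElliptic] [W.IsGloballyMinimal]
    (hW : ∃ C : VariableChange ℚ, C • W = cm7.quadraticTwist ((-(4 * ((1 : ℕ) : ℤ)) : ℤ) : ℚ)) :
    W.analyticRank ≤ 1 :=
  analyticRank_le_one_twist_cm7_even_of_thm120 (n := 1) (r := 31) (hr := ⟨by norm_num⟩)
    (by norm_num) squarefree_one (by norm_num) (by norm_num) (by norm_num) (by norm_num)
    (by rw [legendreSym_eq_ite 7 (by norm_num)]; decide)
    (fun q hq hqn _ => absurd (Nat.dvd_one.mp hqn) hq.ne_one)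
    norm_generalizedBernoulli_theta1_E4 norm_generalizedBernoulli_theta2_E4 h120 hnf hGZ hHP W hW

/-- **Member `n = 2` over `K = ℚ(√−47)`: every level-`3136` Heegner point of a globally minimal model `W` of
`49a1^{(−8)} ≅ 49a1^{(−2)}` (the curve `3136⁻`; `(−2/7) = −1`: INERT half) has infinite order**, granted KL19 Thm. 1.20
only (certificates bsd-cm's `RouteU.norm_generalizedBernoulli_theta1_E8` / `_theta2_E8`, `r = 47`).
[cite: KrizLi2019, Thm. 1.20 (pp. 7–8) and Rem. 1.21] [cite: Washington1997, §5.1] -/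
theorem not_isOfFinAddOrder_heegnerPoint_twist_cm7_neg8_of_thm120
    (h120 : KrizLi2019.thm120_padicLogHeegner_unit_of_bernoulli)
    (W : WeierstrassCurve ℚ) [W.IsElliptic] [W.IsGloballyMinimal]
    (hW : ∃ C : VariableChange ℚ, C • W = cm7.quadraticTwist ((-(4 * ((2 : ℕ) : ℤ)) : ℤ) : ℚ))
    (K : Type) [Field K] [NumberField K] (hK : IsImaginaryQuadratic K) (hdK : NumberField.discr K = -((47 : ℕ) : ℤ))
    {P : (W.baseChange K).toAffine.Point}
    (hP : haveI : NeZero (W.conductorNorm ℤ) := ⟨(W.conductorNorm_pos_holds).ne'⟩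
      IsHeegnerPoint (W.conductorNorm ℤ) W K P) : ¬ IsOfFinAddOrder P :=
  not_isOfFinAddOrder_heegnerPoint_twist_cm7_even_of_thm120 (n := 2) (r := 47) (hr := ⟨by norm_num⟩)
    (by norm_num) (show Nat.Prime 2 by norm_num).squarefree (by norm_num) (by norm_num) (by norm_num) (by norm_num)
    (by rw [legendreSym_eq_ite 7 (by norm_num)]; decide)
    (fun q hq hqn hq2 => absurd ((Nat.prime_dvd_prime_iff_eq hq Nat.prime_two).mp hqn) hq2)
    norm_generalizedBernoulli_theta1_E8 norm_generalizedBernoulli_theta2_E8 h120 W hW K hK hdK hP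

/-- **Member `n = 2`, K12₂″'s implication OUTRIGHT for the models of `49a1^{(−8)}` (the curve `3136⁻`, INERT half):
`corank_{ℤ₂} Sel_{2^∞}(W/ℚ) = 1 ⟹ ord_{s=1} L(W, s) = 1`** (auxiliary field `ℚ(√−47)`; certificates `RouteU.…_E8`).
Hands bsd-cm's `RouteU.bsdp_seven_of_twist_cm7_E8` its binder `hr1` from the corank.
[cite: KrizLi2019, Thm. 1.20 (pp. 7–8)] [cite: GrossZagier1986, I.(6.3) and I.§7] [cite: DokchitserDokchitserAnnals2010, Thm. 1.4] -/
theorem rankOneTwoConverse_twist_cm7_neg8_of_thm120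
    (h120 : KrizLi2019.thm120_padicLogHeegner_unit_of_bernoulli) (hnf : exists_isNewformOf)
    (hGZ : ∀ (N : ℕ) [NeZero N] (V : WeierstrassCurve ℚ) (L : Type) [Field L] [NumberField L], gross_zagier N V L)
    (hHP : ∀ (V : WeierstrassCurve ℚ) (L : Type) [Field L] [NumberField L], exists_isHeegnerPoint V L)
    (hpar : ∀ (V : WeierstrassCurve ℚ) [V.IsElliptic], p_parity V 2)
    (W : WeierstrassCurve ℚ) [W.IsElliptic] [W.IsGloballyMinimal]
    (hW : ∃ C : VariableChange ℚ, C • W = cm7.quadraticTwist ((-(4 * ((2 : ℕ) : ℤ)) : ℤ) : ℚ))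
    (hco : W.selmerCorank 2 = 1) : W.analyticRank = 1 :=
  rankOneTwoConverse_twist_cm7_even_of_thm120 (n := 2) (r := 47) (hr := ⟨by norm_num⟩)
    (by norm_num) (show Nat.Prime 2 by norm_num).squarefree (by norm_num) (by norm_num) (by norm_num) (by norm_num)
    (by rw [legendreSym_eq_ite 7 (by norm_num)]; decide)
    (fun q hq hqn hq2 => absurd ((Nat.prime_dvd_prime_iff_eq hq Nat.prime_two).mp hqn) hq2)
    norm_generalizedBernoulli_theta1_E8 norm_generalizedBernoulli_theta2_E8 h120 hnf hGZ hHP hpar W hW hco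

/-- **Member `n = 2`, unconditional shape: `r_an(W) ≤ 1`** for every globally minimal `W ≅ 49a1^{(−8)}`.
[cite: GrossZagier1986, I.§7] -/
theorem analyticRank_le_one_twist_cm7_neg8_of_thm120
    (h120 : KrizLi2019.thm120_padicLogHeegner_unit_of_bernoulli) (hnf : exists_isNewformOf)
    (hGZ : ∀ (N : ℕ) [NeZero N] (V : WeierstrassCurve ℚ) (L : Type) [Field L] [NumberField L], gross_zagier N V L)
    (hHP : ∀ (V : WeierstrassCurve ℚ) (L : Type) [Field L] [NumberField L], exists_isHeegnerPoint V L)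
    (W : WeierstrassCurve ℚ) [W.IsElliptic] [W.IsGloballyMinimal]
    (hW : ∃ C : VariableChange ℚ, C • W = cm7.quadraticTwist ((-(4 * ((2 : ℕ) : ℤ)) : ℤ) : ℚ)) :
    W.analyticRank ≤ 1 :=
  analyticRank_le_one_twist_cm7_even_of_thm120 (n := 2) (r := 47) (hr := ⟨by norm_num⟩)
    (by norm_num) (show Nat.Prime 2 by norm_num).squarefree (by norm_num) (by norm_num) (by norm_num) (by norm_num)
    (by rw [legendreSym_eq_ite 7 (by norm_num)]; decide)
    (fun q hq hqn hq2 => absurd ((Nat.prime_dvd_prime_iff_eq hq Nat.prime_two).mp hqn) hq2)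
    norm_generalizedBernoulli_theta1_E8 norm_generalizedBernoulli_theta2_E8 h120 hnf hGZ hHP W hW

/-- **Member `n = 22` over `K = ℚ(√−271)`: every level-`379456` Heegner point of a globally minimal model `W` of
`49a1^{(−88)} ≅ 49a1^{(−22)}` (`(−22/7) = −1`: INERT half) has infinite order**, granted KL19 Thm. 1.20 only (certificates
bsd-cm's `RouteU.norm_generalizedBernoulli_theta1_E88` / `_theta2_E88`, `r = 271`; `(−271/11) = 1`).
[cite: KrizLi2019, Thm. 1.20 (pp. 7–8) and Rem. 1.21] [cite: Washington1997, §5.1] -/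
theorem not_isOfFinAddOrder_heegnerPoint_twist_cm7_neg88_of_thm120
    (h120 : KrizLi2019.thm120_padicLogHeegner_unit_of_bernoulli)
    (W : WeierstrassCurve ℚ) [W.IsElliptic] [W.IsGloballyMinimal]
    (hW : ∃ C : VariableChange ℚ, C • W = cm7.quadraticTwist ((-(4 * ((22 : ℕ) : ℤ)) : ℤ) : ℚ))
    (K : Type) [Field K] [NumberField K] (hK : IsImaginaryQuadratic K) (hdK : NumberField.discr K = -((271 : ℕ) : ℤ))
    {P : (W.baseChange K).toAffine.Point}
    (hP : haveI : NeZero (W.conductorNorm ℤ) := ⟨(W.conductorNorm_pos_holds).ne'⟩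
      IsHeegnerPoint (W.conductorNorm ℤ) W K P) : ¬ IsOfFinAddOrder P :=
  not_isOfFinAddOrder_heegnerPoint_twist_cm7_even_of_thm120 (n := 22) (r := 271) (hr := ⟨by norm_num⟩)
    (by norm_num) (by rw [show (22 : ℕ) = 2 * 11 by norm_num]; exact (Nat.squarefree_mul (by norm_num)).mpr ⟨(show Nat.Prime 2 by norm_num).squarefree, (show Nat.Prime 11 by norm_num).squarefree⟩)
    (by norm_num) (by norm_num) (by norm_num) (by norm_num)
    (by rw [legendreSym_eq_ite 7 (by norm_num)]; decide)
    (fun q hq hqn hq2 => by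
      rcases (Nat.Prime.dvd_mul hq : q ∣ 2 * 11 ↔ _).mp (by simpa using hqn) with h | h
      · exact absurd ((Nat.prime_dvd_prime_iff_eq hq Nat.prime_two).mp h) hq2
      · rw [(Nat.prime_dvd_prime_iff_eq hq (by norm_num : Nat.Prime 11)).mp h,
          jacobiSym_prime_eq_ite 11 (by norm_num) (by norm_num)]; decide)
    norm_generalizedBernoulli_theta1_E88 norm_generalizedBernoulli_theta2_E88 h120 W hW K hK hdK hP

/-- **Member `n = 22`, K12₂″'s implication OUTRIGHT for the models of `49a1^{(−88)}` (INERT half, `N = 379456`):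
`corank_{ℤ₂} Sel_{2^∞}(W/ℚ) = 1 ⟹ ord_{s=1} L(W, s) = 1`** (auxiliary field `ℚ(√−271)`; certificates `RouteU.…_E88`).
Hands bsd-cm's `RouteU.bsdp_seven_of_twist_cm7_E88` its binder `hr1` from the corank.
[cite: KrizLi2019, Thm. 1.20 (pp. 7–8)] [cite: GrossZagier1986, I.(6.3) and I.§7] [cite: DokchitserDokchitserAnnals2010, Thm. 1.4] -/
theorem rankOneTwoConverse_twist_cm7_neg88_of_thm120
    (h120 : KrizLi2019.thm120_padicLogHeegner_unit_of_bernoulli) (hnf : exists_isNewformOf)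
    (hGZ : ∀ (N : ℕ) [NeZero N] (V : WeierstrassCurve ℚ) (L : Type) [Field L] [NumberField L], gross_zagier N V L)
    (hHP : ∀ (V : WeierstrassCurve ℚ) (L : Type) [Field L] [NumberField L], exists_isHeegnerPoint V L)
    (hpar : ∀ (V : WeierstrassCurve ℚ) [V.IsElliptic], p_parity V 2)
    (W : WeierstrassCurve ℚ) [W.IsElliptic] [W.IsGloballyMinimal]
    (hW : ∃ C : VariableChange ℚ, C • W = cm7.quadraticTwist ((-(4 * ((22 : ℕ) : ℤ)) : ℤ) : ℚ))
    (hco : W.selmerCorank 2 = 1) : W.analyticRank = 1 :=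
  rankOneTwoConverse_twist_cm7_even_of_thm120 (n := 22) (r := 271) (hr := ⟨by norm_num⟩)
    (by norm_num) (by rw [show (22 : ℕ) = 2 * 11 by norm_num]; exact (Nat.squarefree_mul (by norm_num)).mpr ⟨(show Nat.Prime 2 by norm_num).squarefree, (show Nat.Prime 11 by norm_num).squarefree⟩)
    (by norm_num) (by norm_num) (by norm_num) (by norm_num)
    (by rw [legendreSym_eq_ite 7 (by norm_num)]; decide)
    (fun q hq hqn hq2 => by
      rcases (Nat.Prime.dvd_mul hq : q ∣ 2 * 11 ↔ _).mp (by simpa using hqn) with h | h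
      · exact absurd ((Nat.prime_dvd_prime_iff_eq hq Nat.prime_two).mp h) hq2
      · rw [(Nat.prime_dvd_prime_iff_eq hq (by norm_num : Nat.Prime 11)).mp h,
          jacobiSym_prime_eq_ite 11 (by norm_num) (by norm_num)]; decide)
    norm_generalizedBernoulli_theta1_E88 norm_generalizedBernoulli_theta2_E88 h120 hnf hGZ hHP hpar W hW hco

/-- **Member `n = 22`, unconditional shape: `r_an(W) ≤ 1`** for every globally minimal `W ≅ 49a1^{(−88)}`.
[cite: GrossZagier1986, I.§7] -/
theorem analyticRank_le_one_twist_cm7_neg88_of_thm120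
    (h120 : KrizLi2019.thm120_padicLogHeegner_unit_of_bernoulli) (hnf : exists_isNewformOf)
    (hGZ : ∀ (N : ℕ) [NeZero N] (V : WeierstrassCurve ℚ) (L : Type) [Field L] [NumberField L], gross_zagier N V L)
    (hHP : ∀ (V : WeierstrassCurve ℚ) (L : Type) [Field L] [NumberField L], exists_isHeegnerPoint V L)
    (W : WeierstrassCurve ℚ) [W.IsElliptic] [W.IsGloballyMinimal]
    (hW : ∃ C : VariableChange ℚ, C • W = cm7.quadraticTwist ((-(4 * ((22 : ℕ) : ℤ)) : ℤ) : ℚ)) :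
    W.analyticRank ≤ 1 :=
  analyticRank_le_one_twist_cm7_even_of_thm120 (n := 22) (r := 271) (hr := ⟨by norm_num⟩)
    (by norm_num) (by rw [show (22 : ℕ) = 2 * 11 by norm_num]; exact (Nat.squarefree_mul (by norm_num)).mpr ⟨(show Nat.Prime 2 by norm_num).squarefree, (show Nat.Prime 11 by norm_num).squarefree⟩)
    (by norm_num) (by norm_num) (by norm_num) (by norm_num)
    (by rw [legendreSym_eq_ite 7 (by norm_num)]; decide)
    (fun q hq hqn hq2 => by
      rcases (Nat.Prime.dvd_mul hq : q ∣ 2 * 11 ↔ _).mp (by simpa using hqn) with h | h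
      · exact absurd ((Nat.prime_dvd_prime_iff_eq hq Nat.prime_two).mp h) hq2
      · rw [(Nat.prime_dvd_prime_iff_eq hq (by norm_num : Nat.Prime 11)).mp h,
          jacobiSym_prime_eq_ite 11 (by norm_num) (by norm_num)]; decide)
    norm_generalizedBernoulli_theta1_E88 norm_generalizedBernoulli_theta2_E88 h120 hnf hGZ hHP W hW

end Summit.BirchSwinnertonDyer.BirchSwinnertonDyer.Theorems.GoldfeldGoodTwists

end
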